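import Literature.NumberTheory.Automorphic.U21WeightVectorsFiltrationBound   -- ★ p832358 (A-p14 (g23)): N3e-2 `finrank_weightVectors_inf_upqPFiltration_le`
import Literature.NumberTheory.Automorphic.GKModulesAdmissibleOfEigenspaces   -- ★ transport lemma `IsGKModule.IntertwiningMap.apply_eq_of_apply_eq_of_mem_adjoin`
import Literature.NumberTheory.Automorphic.GKModulesDixmierSchur             -- ★ p830646 (A-p06 (g24)): N0 `exists_upqCasimirOp_harishChandra_eq_smul`
import Literature.RepresentationTheory.IntertwiningMapEvalInjective           -- ★ p831571 (A-p06 (g24)): G2 `finrank_intertwiningMap_le_finrank_weightVectors`, `exists_highestWeightVector`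
import Literature.RepresentationTheory.IntertwiningMapFiltrationTelescope      -- ★ p831104 (A-p06 (g24)): N4b `finrank_intertwiningMap_eq_add_sum_orthogonal`
import HarnessLib

/-!
# `U(2,1)`: Harish-Chandra's bound on `K`-multiplicities along the `𝔭`-filtration of an irreducible unitary representation — the level bound `N3`

Topic `NumberTheory/Automorphic`; namespace `Literature.NumberTheory.Automorphic`.  THEOREMS ONLY (no `def`, no named fact, no instance, no notation, no
`sorry`).  Cell `hodgecm-mathlib`, F0∕P3, T1a arch line, road «V19 in-house for `U(2,1)`»: this file discharges, BY NAME and in the frozen currency of the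
registered pay-down line `Summits/HodgeConjecture/HodgeConjecture/Cruxes/H413/Lines/F0_T1a_V19KTypeGrowthPaydown.lean` (ED. 1, desk F0P3b-plan (g10),
skeleton A-p06 (g24)), its ONE open stub `stub_N3 : LevelBound₂₁` — with the filtration `F` abstracted to any chain of `K`-subrepresentations whose
underlying subspaces are ★ `upqPFiltration dϖ W₀ m` (the line's `pFiltSubrep hϖ W₀ hW₀ m` is one such, by its `pFiltSubrep_toSubmodule`), so that the
desk closes the stub by `obtain ⟨B, hB⟩ := u21_levelBound hϖ W₀ hW₀ hne hirr; exact ⟨B, fun W _ _ _ τ hτ Q h₁ h₂ h₃ h₄ n => hB W τ hτ _ (pFiltSubrep_toSubmodule hϖ W₀ hW₀) Q h₁ h₂ h₃ h₄ n⟩`.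
Node **N3e-3** (seat A-p14 (g23); LEAD F0P3b-p01 (g2)).

THE MATHEMATICS ([Varadarajan1989, §5.4 Thm. 22]; [Knapp1986, Thm. 8.1]; [BorelWallach2000, II §4.2]; [KnappVogan1995, §I.4, §IV.6]).  Let `ϖ` be an
irreducible unitary representation of `U(2,1)`, `H = H_K^∞` its Harish-Chandra module (★ `harishChandraSpace`, a `(𝔤, K)`-module with scalar Casimir,
★ N0), `W₀ ⊂ H` an irreducible `K`-type (finite-dimensional, `K`-stable, `K`-irreducible), `F_n = Σ_{a+b≤n} F^b E^a W₀` its `𝔭`-filtration (★ N1).  THEN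
for every irreducible `K`-module `τ` and every `n`,
  **`dim Hom_K(τ, F_n) ≤ dim W₀`**   (`u21_finrank_intertwiningMap_upqPFiltration_le`),
hence (★ N4b, `F_n = F_0 ⊕ Q_1 ⊕ ⋯ ⊕ Q_n` orthogonally) **`dim Hom_K(τ, F_0) + Σ_{m<n} dim Hom_K(τ, Q_{m+1}) ≤ dim W₀ · dim τ`** — the line's `LevelBound₂₁`
with `B := dim W₀` (`u21_levelBound`).  PROOF: `z₀ ∈ 𝔷(𝔨)` acts on the irreducible `W₀` by a scalar `ζ₀` (§1, Schur); if `Hom_K(τ, F_n) ≠ 0` pick an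
injective `K`-map `j₀ : τ → F_n ⊂ H` and pull the `𝔨_ℂ`-operators `e, h, z` back to `τ` along `j₀` (§2); by the tree's TRANSPORT LEMMA every `K`-map
`j : τ → F_n` then intertwines them, so evaluation at a joint highest weight vector `w₀ ∈ τ` (★ G2 `exists_highestWeightVector`) embeds `Hom_K(τ, F_n)`
into the joint highest weight vectors `{v ∈ F_n | e v = 0, h v = μ v, z v = ζ v}` (★ G2), which are at most `dim W₀` in number (★ N3e-2).

HONEST LABEL: this closes the ARITHMETIC of the V19 pay-down for `U(2,1)` (the line's `stub_N3`); the line's head `kTypeGrowth₂₁_holds` then follows inside the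
line by its own ★ plumbing.  HC_CM is proved only modulo the 2 remaining named inputs (hLiu418, h413) until rung 0 closes.

## References
* V. S. Varadarajan, *An Introduction to Harmonic Analysis on Semisimple Lie Groups* (1989), §5.4 Thm. 22. [Varadarajan1989]
* A. W. Knapp, *Representation Theory of Semisimple Groups* (1986), Thm. 8.1. [Knapp1986]
* A. Borel, N. Wallach, *Continuous Cohomology, Discrete Subgroups, and Representations of Reductive Groups*, 2nd ed. (2000), II §4.2. [BorelWallach2000]
* A. W. Knapp, D. A. Vogan, *Cohomological Induction and Unitary Representations* (1995), §I.4, §IV.6. [KnappVogan1995]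
-/

-- Mathlib idiom (as in ★ `GKModules` and every `(𝔤, K)` file of the tree): the commutator bracket on `Module.End ℂ V` and on matrices, needed to
-- MENTION `ρ𝔤 : (uFormGroup α β).lie →ₗ⁅ℝ⁆ Module.End ℂ V` (`LieRing.ofAssociativeRing` is a `def` in Mathlib, not a global instance).
attribute [local instance 100] LieRing.ofAssociativeRing

set_option autoImplicit false

open scoped MatrixGroups Matrix ComplexConjugate InnerProductSpace

noncomputable section

namespace Literature.NumberTheory.Automorphic

open Literature.RepresentationTheory Literature.RepresentationTheory.BorelWallach2000 Literature.RepresentationTheory.KonnoKonno2007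
open Literature.Algebra.Lie Module

universe w

/-! ## §1 Linear-algebra helpers: pulling an operator back along an injective map -/

/-- **Pull-back of an operator along an injective linear map**: if `T` maps `j₀(W)` into itself then `T ∘ j₀ = j₀ ∘ T_W` for some `T_W ∈ End W`.
[cite: KnappVogan1995, §I.4 (1.64)–(1.65)] -/
theorem exists_pullback_of_injective {W V : Type*} [AddCommGroup W] [Module ℂ W] [AddCommGroup V] [Module ℂ V] (j₀ : W →ₗ[ℂ] V)
    (hj₀ : Function.Injective j₀) (T : Module.End ℂ V) (hT : ∀ w : W, T (j₀ w) ∈ LinearMap.range j₀) :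
    ∃ T_W : Module.End ℂ W, ∀ w : W, j₀ (T_W w) = T (j₀ w) := by
  let ε : W ≃ₗ[ℂ] LinearMap.range j₀ := LinearEquiv.ofInjective j₀ hj₀
  refine ⟨ε.symm.toLinearMap ∘ₗ (T ∘ₗ j₀).codRestrict (LinearMap.range j₀) hT, fun w => ?_⟩
  have h1 : ∀ y : LinearMap.range j₀, j₀ (ε.symm y) = y := fun y => by
    rw [← LinearEquiv.ofInjective_apply (h := hj₀), LinearEquiv.apply_symm_apply]
  rw [LinearMap.comp_apply, LinearEquiv.coe_coe, h1]
  rfl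

/-! ## §2 `z₀` acts on an irreducible `K`-type by a scalar -/

variable {V : Type*} [AddCommGroup V] [Module ℂ V]
  {ρK : Representation ℂ (uFormGroup (Fin 2) (Fin 1)).maximalCompact V} {ρ𝔤 : (uFormGroup (Fin 2) (Fin 1)).lie →ₗ⁅ℝ⁆ Module.End ℂ V}

/-- `ρ𝔤(z₀)` commutes with `K` (`Ad(k) z₀ = z₀`, ★ `upq_Ad_upqZ0`). [cite: BorelWallach2000, II §4.1] -/
theorem ρK_comp_ρ𝔤_upqZ0 (hV : IsGKModule (uFormGroup (Fin 2) (Fin 1)) ρK ρ𝔤) (k : (uFormGroup (Fin 2) (Fin 1)).maximalCompact) :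
    ρK k ∘ₗ ρ𝔤 (upqZ0 (Fin 2) (Fin 1)) = ρ𝔤 (upqZ0 (Fin 2) (Fin 1)) ∘ₗ ρK k := by
  have h := hV.ad_compat k (upqZ0 (Fin 2) (Fin 1))
  rw [upq_Ad_upqZ0] at h
  have hinv : ρK k⁻¹ ∘ₗ ρK k = LinearMap.id := by
    rw [← Module.End.mul_eq_comp, ← map_mul, inv_mul_cancel, map_one, Module.End.one_eq_id]
  conv_rhs => rw [← h]
  rw [LinearMap.comp_assoc, LinearMap.comp_assoc, hinv, LinearMap.comp_id]

/-- **Schur for `z₀` on an irreducible `K`-type**: a finite-dimensional non-zero `K`-stable `K`-irreducible `W₀` lies in one eigenspace of `ρ𝔤(z₀)`.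
[cite: KnappVogan1995, §IV.6] [cite: BorelWallach2000, II §4.1] -/
theorem exists_le_eigenspace_upqZ0_of_irreducible (hV : IsGKModule (uFormGroup (Fin 2) (Fin 1)) ρK ρ𝔤) (W₀ : Submodule ℂ V) [FiniteDimensional ℂ W₀]
    (hW₀ : ∀ (k : (uFormGroup (Fin 2) (Fin 1)).maximalCompact), ∀ w ∈ W₀, ρK k w ∈ W₀) (hW₀ne : W₀ ≠ ⊥)
    (hirr : ∀ U : Submodule ℂ V, U ≤ W₀ → (∀ (k : (uFormGroup (Fin 2) (Fin 1)).maximalCompact), ∀ u ∈ U, ρK k u ∈ U) → U = ⊥ ∨ U = W₀) :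
    ∃ ζ₀ : ℂ, W₀ ≤ (ρ𝔤 (upqZ0 (Fin 2) (Fin 1))).eigenspace ζ₀ := by
  have hzW₀ : ∀ x ∈ W₀, ρ𝔤 (upqZ0 (Fin 2) (Fin 1)) x ∈ W₀ := fun x hx => apply_mem_of_K_stable_of_mem_kInLie ρK hV hW₀ upqZ0_mem_kInLie hx
  haveI : Nontrivial W₀ := Submodule.nontrivial_iff_ne_bot.mpr hW₀ne
  obtain ⟨ζ₀, hζ₀⟩ := Module.End.exists_eigenvalue ((ρ𝔤 (upqZ0 (Fin 2) (Fin 1))).restrict hzW₀)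
  refine ⟨ζ₀, ?_⟩
  -- `U := W₀ ∩ ker (z − ζ₀)` is `K`-stable and non-zero, hence `= W₀`
  have hUK : ∀ (k : (uFormGroup (Fin 2) (Fin 1)).maximalCompact), ∀ u ∈ W₀ ⊓ (ρ𝔤 (upqZ0 (Fin 2) (Fin 1))).eigenspace ζ₀,
      ρK k u ∈ W₀ ⊓ (ρ𝔤 (upqZ0 (Fin 2) (Fin 1))).eigenspace ζ₀ := by
    intro k u hu
    refine Submodule.mem_inf.mpr ⟨hW₀ k u hu.1, ?_⟩
    rw [Module.End.mem_eigenspace_iff, ← LinearMap.comp_apply, ← ρK_comp_ρ𝔤_upqZ0 hV k, LinearMap.comp_apply,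
      Module.End.mem_eigenspace_iff.mp hu.2, map_smul]
  have hUne : W₀ ⊓ (ρ𝔤 (upqZ0 (Fin 2) (Fin 1))).eigenspace ζ₀ ≠ ⊥ := by
    obtain ⟨v, hv, hv0⟩ := hζ₀.exists_hasEigenvector
    rw [Submodule.ne_bot_iff]
    refine ⟨(v : V), Submodule.mem_inf.mpr ⟨v.2, ?_⟩, fun h => hv0 (Subtype.ext h)⟩
    rw [Module.End.mem_eigenspace_iff]
    have h1 := Module.End.mem_eigenspace_iff.mp hv
    have h2 := congrArg (fun y : W₀ => (y : V)) h1
    simpa [LinearMap.restrict_apply] using h2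
  rcases hirr _ inf_le_left hUK with h | h
  · exact absurd h hUne
  · intro x hx
    have hx' : x ∈ W₀ ⊓ (ρ𝔤 (upqZ0 (Fin 2) (Fin 1))).eigenspace ζ₀ := by rw [h]; exact hx
    exact hx'.2

/-! ## §3 The Harish-Chandra module of an irreducible unitary representation of `U(2,1)`: `dim Hom_K(τ, F_n) ≤ dim W₀` -/

/-- The inclusion of a `K`-subrepresentation, as an intertwining map. [cite: KnappVogan1995, §I.3] -/
theorem exists_intertwiningMap_subtype {G : Type*} [Group G] {V : Type*} [AddCommGroup V] [Module ℂ V] {σ : Representation ℂ G V}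
    (P : Subrepresentation σ) : ∃ ι : Representation.IntertwiningMap P.toRepresentation σ, ∀ v, ι v = (v : V) :=
  ⟨LinearMap.intertwiningMap_of_isIntertwiningMap P.toRepresentation σ P.toSubmodule.subtype (fun _ _ => rfl), fun _ => rfl⟩

/-- **`dim Hom_K(τ, F_n) ≤ dim W₀`** for the `𝔭`-filtration `F_n` of the Harish-Chandra module of an irreducible unitary representation of `U(2,1)` generated by
an irreducible `K`-type `W₀`, and any irreducible finite-dimensional `K`-module `τ` — uniformly in `n` and `τ`.
[cite: Varadarajan1989, §5.4 Thm. 22] [cite: Knapp1986, Thm. 8.1] [cite: KnappVogan1995, §IV.6] -/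
theorem u21_finrank_intertwiningMap_upqPFiltration_le {x : GKIrrClass (uFormGroup (Fin 2) (Fin 1))}
    {E : Type} [NormedAddCommGroup E] [InnerProductSpace ℂ E] [CompleteSpace E] {ϖ : ContRepresentation ℂ (uFormGroup (Fin 2) (Fin 1)).carrier E}
    (hϖ : IsUnitaryGlobalization (uFormGroup (Fin 2) (Fin 1)) x ϖ) (W₀ : Submodule ℂ (harishChandraSpace (uFormGroup (Fin 2) (Fin 1)) ϖ))
    [FiniteDimensional ℂ W₀]
    (hW₀ : ∀ (k : (uFormGroup (Fin 2) (Fin 1)).maximalCompact), ∀ w ∈ W₀, harishChandraRepK (uFormGroup (Fin 2) (Fin 1)) ϖ k w ∈ W₀) (hW₀ne : W₀ ≠ ⊥)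
    (hirr : ∀ U : Submodule ℂ (harishChandraSpace (uFormGroup (Fin 2) (Fin 1)) ϖ), U ≤ W₀ →
      (∀ (k : (uFormGroup (Fin 2) (Fin 1)).maximalCompact), ∀ u ∈ U, harishChandraRepK (uFormGroup (Fin 2) (Fin 1)) ϖ k u ∈ U) → U = ⊥ ∨ U = W₀)
    {W : Type w} [AddCommGroup W] [Module ℂ W] [FiniteDimensional ℂ W] (τ : Representation ℂ (uFormGroup (Fin 2) (Fin 1)).maximalCompact W)
    (hτ : τ.IsIrreducible) (P : Subrepresentation (harishChandraRepK (uFormGroup (Fin 2) (Fin 1)) ϖ)) {n : ℕ}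
    (hP : P.toSubmodule = upqPFiltration (harishChandraRepLie (uFormGroup (Fin 2) (Fin 1)) ϖ hϖ.isStronglyContinuous) W₀ n) :
    finrank ℂ (Representation.IntertwiningMap τ P.toRepresentation) ≤ finrank ℂ W₀ := by
  -- the `(𝔤, K)`-module `H = H_K^∞`
  have hV : IsGKModule (uFormGroup (Fin 2) (Fin 1)) (harishChandraRepK (uFormGroup (Fin 2) (Fin 1)) ϖ) (harishChandraRepLie (uFormGroup (Fin 2) (Fin 1)) ϖ hϖ.isStronglyContinuous) :=
    isGKModule_harishChandra_holds (uFormGroup (Fin 2) (Fin 1)) ϖ hϖ.isStronglyContinuous (harishChandraRepK (uFormGroup (Fin 2) (Fin 1)) ϖ) (fun _ _ => rfl) (isHarishChandraModuleOf_harishChandraRepLie (uFormGroup (Fin 2) (Fin 1)) ϖ hϖ.isStronglyContinuous)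
  obtain ⟨c, hc⟩ := exists_upqCasimirOp_harishChandra_eq_smul hϖ
  have hC : upqCasimirOp (harishChandraRepLie (uFormGroup (Fin 2) (Fin 1)) ϖ hϖ.isStronglyContinuous) = algebraMap ℂ (Module.End ℂ (harishChandraSpace (uFormGroup (Fin 2) (Fin 1)) ϖ)) c := by
    ext v; rw [hc, Module.algebraMap_end_apply]
  obtain ⟨ζ₀, hζ₀⟩ := exists_le_eigenspace_upqZ0_of_irreducible hV W₀ hW₀ hW₀ne hirr
  haveI : τ.IsIrreducible := hτ
  haveI hPfd : FiniteDimensional ℂ P.toSubmodule := by rw [hP]; exact finiteDimensional_upqPFiltration (ρ𝔤 := harishChandraRepLie (uFormGroup (Fin 2) (Fin 1)) ϖ hϖ.isStronglyContinuous) W₀ n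
  set σ := P.toRepresentation with hσ
  -- the three operators `e, h, z` and their membership in the `𝔨`-algebra
  set e := u21e (harishChandraRepLie (uFormGroup (Fin 2) (Fin 1)) ϖ hϖ.isStronglyContinuous) with he_def
  set h := u21h (harishChandraRepLie (uFormGroup (Fin 2) (Fin 1)) ϖ hϖ.isStronglyContinuous) with hh_def
  set z := (harishChandraRepLie (uFormGroup (Fin 2) (Fin 1)) ϖ hϖ.isStronglyContinuous) (upqZ0 (Fin 2) (Fin 1)) with hz_def
  have he_adj := u21e_mem_adjoin (harishChandraRepLie (uFormGroup (Fin 2) (Fin 1)) ϖ hϖ.isStronglyContinuous)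
  have hh_adj := u21h_mem_adjoin (harishChandraRepLie (uFormGroup (Fin 2) (Fin 1)) ϖ hϖ.isStronglyContinuous)
  have hz_adj : z ∈ Algebra.adjoin ℂ (Set.range fun Y : (uFormGroup (Fin 2) (Fin 1)).compactLie => (harishChandraRepLie (uFormGroup (Fin 2) (Fin 1)) ϖ hϖ.isStronglyContinuous) (LieSubalgebra.inclusion (uFormGroup (Fin 2) (Fin 1)).compactLie_le_lie Y)) := by
    obtain ⟨Y₀, hY₀⟩ := (upqZ0_mem_kInLie : upqZ0 (Fin 2) (Fin 1) ∈ (uFormGroup (Fin 2) (Fin 1)).kInLie)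
    rw [hz_def, ← hY₀]
    exact Algebra.subset_adjoin ⟨Y₀, rfl⟩
  -- `P = F_n` is stable under them
  have hPK : ∀ (k : (uFormGroup (Fin 2) (Fin 1)).maximalCompact), ∀ u ∈ P.toSubmodule, (harishChandraRepK (uFormGroup (Fin 2) (Fin 1)) ϖ) k u ∈ P.toSubmodule := fun k u hu => P.apply_mem_toSubmodule k hu
  have hPe : ∀ u ∈ P.toSubmodule, e u ∈ P.toSubmodule := fun u hu => IsGKModule.apply_mem_of_K_stable_of_mem_adjoin hV hPK he_adj hu
  have hPh : ∀ u ∈ P.toSubmodule, h u ∈ P.toSubmodule := fun u hu => IsGKModule.apply_mem_of_K_stable_of_mem_adjoin hV hPK hh_adj hu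
  have hPz : ∀ u ∈ P.toSubmodule, z u ∈ P.toSubmodule := fun u hu => IsGKModule.apply_mem_of_K_stable_of_mem_adjoin hV hPK hz_adj hu
  -- trivial case: no non-zero `K`-map
  by_cases hex : ∃ j₁ : Representation.IntertwiningMap τ σ, j₁ ≠ 0
  swap
  · simp only [not_exists, not_not] at hex
    haveI : Subsingleton (Representation.IntertwiningMap τ σ) := ⟨fun a b => by rw [hex a, hex b]⟩
    rw [finrank_zero_of_subsingleton]
    exact Nat.zero_le _
  obtain ⟨j₁, hj₁⟩ := hex
  have hj₁inj : Function.Injective j₁ := (Representation.IsIrreducible.injective_or_eq_zero j₁).resolve_right hj₁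
  -- `j₀ = ι ∘ j₁ : τ → H`, injective
  obtain ⟨ι, hι⟩ := exists_intertwiningMap_subtype P
  set j₀ : Representation.IntertwiningMap τ (harishChandraRepK (uFormGroup (Fin 2) (Fin 1)) ϖ) := ι.comp j₁ with hj₀_def
  have hj₀ : ∀ w, j₀ w = ((j₁ w : P.toSubmodule) : harishChandraSpace (uFormGroup (Fin 2) (Fin 1)) ϖ) := fun w => by
    rw [hj₀_def, Representation.IntertwiningMap.comp_apply, hι]
  have hj₀inj : Function.Injective j₀ := fun a b hab => hj₁inj (Subtype.ext (by rwa [hj₀, hj₀] at hab))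
  have hj₀range : ∀ w, j₀ w ∈ LinearMap.range j₀.toLinearMap := fun w => ⟨w, rfl⟩
  have hUK := IsGKModule.range_K_stable (ρK := harishChandraRepK (uFormGroup (Fin 2) (Fin 1)) ϖ) j₀
  -- pull back `e, h, z` to `W`
  have hpull : ∀ {T : Module.End ℂ (harishChandraSpace (uFormGroup (Fin 2) (Fin 1)) ϖ)},
      T ∈ Algebra.adjoin ℂ (Set.range fun Y : (uFormGroup (Fin 2) (Fin 1)).compactLie => (harishChandraRepLie (uFormGroup (Fin 2) (Fin 1)) ϖ hϖ.isStronglyContinuous) (LieSubalgebra.inclusion (uFormGroup (Fin 2) (Fin 1)).compactLie_le_lie Y)) →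
      ∃ T_W : Module.End ℂ W, ∀ w : W, j₀ (T_W w) = T (j₀ w) := fun {T} hT =>
    exists_pullback_of_injective j₀.toLinearMap hj₀inj T fun w => IsGKModule.apply_mem_of_K_stable_of_mem_adjoin hV hUK hT (hj₀range w)
  obtain ⟨eW, heW⟩ := hpull he_adj
  obtain ⟨hW', hhW⟩ := hpull hh_adj
  obtain ⟨zW, hzW⟩ := hpull hz_adj
  -- relations on `W` (pulled back through the injective `j₀`)
  have hze_comm : z * e = e * z := by
    rw [hz_def, he_def, ρ𝔤_upqZ0_eq, u21e]
    exact upqLieC_comm_of_comm (harishChandraRepLie (uFormGroup (Fin 2) (Fin 1)) ϖ hϖ.isStronglyContinuous) (by rw [Matrix.fromBlocks_multiply, Matrix.fromBlocks_multiply]; simp)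
  have hzh_comm : z * h = h * z := by
    rw [hz_def, hh_def, ρ𝔤_upqZ0_eq, u21h]
    exact upqLieC_comm_of_comm (harishChandraRepLie (uFormGroup (Fin 2) (Fin 1)) ϖ hϖ.isStronglyContinuous) (by rw [Matrix.fromBlocks_multiply, Matrix.fromBlocks_multiply]; simp)
  have heh_W : hW' * eW - eW * hW' = (2 : ℂ) • eW := by
    ext w
    apply hj₀inj
    rw [LinearMap.sub_apply, Module.End.mul_apply, Module.End.mul_apply, map_sub, hhW, heW, heW, hhW, LinearMap.smul_apply, map_smul, heW,
      ← Module.End.mul_apply, ← Module.End.mul_apply, ← LinearMap.sub_apply, u21h_mul_u21e_sub, LinearMap.smul_apply]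
  have hze_W : Commute zW eW := by
    ext w
    apply hj₀inj
    rw [Module.End.mul_apply, Module.End.mul_apply, hzW, heW, heW, hzW, ← Module.End.mul_apply, hze_comm, Module.End.mul_apply]
  have hzh_W : Commute zW hW' := by
    ext w
    apply hj₀inj
    rw [Module.End.mul_apply, Module.End.mul_apply, hzW, hhW, hhW, hzW, ← Module.End.mul_apply, hzh_comm, Module.End.mul_apply]
  -- a joint highest weight vector in `τ`
  haveI : Nontrivial W := by
    by_contra hW
    rw [not_nontrivial_iff_subsingleton] at hW
    haveI := (Submodule.subsingleton_iff ℂ).mpr hW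
    exact hτ.bot_ne_top (Subrepresentation.toSubmodule_injective (Subsingleton.elim _ _))
  obtain ⟨w₀, hw₀, μ, ζ, he0, hμ, hζ⟩ := exists_highestWeightVector eW hW' zW heh_W hze_W hzh_W
  -- the restricted operators on `Q = F_n` and the intertwining relations (transport lemma)
  have htrans : ∀ {T : Module.End ℂ (harishChandraSpace (uFormGroup (Fin 2) (Fin 1)) ϖ)} {T_W : Module.End ℂ W}
      (hT : T ∈ Algebra.adjoin ℂ (Set.range fun Y : (uFormGroup (Fin 2) (Fin 1)).compactLie => (harishChandraRepLie (uFormGroup (Fin 2) (Fin 1)) ϖ hϖ.isStronglyContinuous) (LieSubalgebra.inclusion (uFormGroup (Fin 2) (Fin 1)).compactLie_le_lie Y)))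
      (hTW : ∀ w : W, j₀ (T_W w) = T (j₀ w)) (hPT : ∀ u ∈ P.toSubmodule, T u ∈ P.toSubmodule)
      (j : Representation.IntertwiningMap τ σ) (w : W), j (T_W w) = T.restrict hPT (j w) := by
    intro T T_W hT hTW hPT j w
    apply Subtype.ext
    rw [LinearMap.coe_restrict_apply]
    have := IsGKModule.IntertwiningMap.apply_eq_of_apply_eq_of_mem_adjoin hV j₀ (ι.comp j) hj₀inj hT (hTW w)
    rwa [Representation.IntertwiningMap.comp_apply, Representation.IntertwiningMap.comp_apply, hι, hι] at this
  have hG2 := (finrank_intertwiningMap_le_finrank_weightVectors τ σ (htrans he_adj heW hPe) (htrans hh_adj hhW hPh) (htrans hz_adj hzW hPz)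
    hw₀ he0 hμ hζ).2
  refine hG2.trans (le_trans ?_ (finrank_weightVectors_inf_upqPFiltration_le (harishChandraRepK (uFormGroup (Fin 2) (Fin 1)) ϖ) hV hC hW₀ hζ₀ μ ζ n))
  -- the weight vectors of `Q` embed into those of `H` inside `F_n`
  let emb : ↥(LinearMap.ker (e.restrict hPe) ⊓ Module.End.eigenspace (h.restrict hPh) μ ⊓ Module.End.eigenspace (z.restrict hPz) ζ) →ₗ[ℂ]
      ↥(LinearMap.ker e ⊓ Module.End.eigenspace h μ ⊓ Module.End.eigenspace z ζ ⊓ upqPFiltration (harishChandraRepLie (uFormGroup (Fin 2) (Fin 1)) ϖ hϖ.isStronglyContinuous) W₀ n) :=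
    { toFun := fun v => ⟨((v : P.toSubmodule) : harishChandraSpace (uFormGroup (Fin 2) (Fin 1)) ϖ), by
          obtain ⟨h12, h3⟩ := Submodule.mem_inf.mp v.2
          obtain ⟨h1, h2⟩ := Submodule.mem_inf.mp h12
          refine Submodule.mem_inf.mpr ⟨Submodule.mem_inf.mpr ⟨Submodule.mem_inf.mpr ⟨?_, ?_⟩, ?_⟩, hP ▸ (v : P.toSubmodule).2⟩
          · rw [LinearMap.mem_ker] at h1 ⊢
            have := congrArg (fun y : P.toSubmodule => (y : harishChandraSpace (uFormGroup (Fin 2) (Fin 1)) ϖ)) h1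
            simpa [LinearMap.coe_restrict_apply] using this
          · rw [Module.End.mem_eigenspace_iff] at h2 ⊢
            have := congrArg (fun y : P.toSubmodule => (y : harishChandraSpace (uFormGroup (Fin 2) (Fin 1)) ϖ)) h2
            simpa [LinearMap.coe_restrict_apply] using this
          · rw [Module.End.mem_eigenspace_iff] at h3 ⊢
            have := congrArg (fun y : P.toSubmodule => (y : harishChandraSpace (uFormGroup (Fin 2) (Fin 1)) ϖ)) h3
            simpa [LinearMap.coe_restrict_apply] using this⟩
      map_add' := fun _ _ => rfl
      map_smul' := fun _ _ => rfl }
  haveI : FiniteDimensional ℂ ↥(LinearMap.ker e ⊓ Module.End.eigenspace h μ ⊓ Module.End.eigenspace z ζ ⊓ upqPFiltration (harishChandraRepLie (uFormGroup (Fin 2) (Fin 1)) ϖ hϖ.isStronglyContinuous) W₀ n) := by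
    haveI := finiteDimensional_upqPFiltration (ρ𝔤 := harishChandraRepLie (uFormGroup (Fin 2) (Fin 1)) ϖ hϖ.isStronglyContinuous) W₀ n
    exact Submodule.finiteDimensional_inf_right _ _
  refine LinearMap.finrank_le_finrank_of_injective (f := emb) fun a b hab => ?_
  apply Subtype.ext; apply Subtype.ext
  exact congrArg (fun y : ↥(LinearMap.ker e ⊓ Module.End.eigenspace h μ ⊓ Module.End.eigenspace z ζ ⊓ upqPFiltration (harishChandraRepLie (uFormGroup (Fin 2) (Fin 1)) ϖ hϖ.isStronglyContinuous) W₀ n) =>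
    (y : harishChandraSpace (uFormGroup (Fin 2) (Fin 1)) ϖ)) hab

/-! ## §4 The line's `LevelBound₂₁` with `B := dim W₀` -/

/-- **THE LEVEL BOUND `N3` (the line's `stub_N3 : LevelBound₂₁`, filtration abstracted):** for the Harish-Chandra module of an irreducible unitary
representation of `U(2,1)` and an irreducible `K`-type `W₀`, there is `B` (namely `dim W₀`) such that for every irreducible `K`-module `τ`, every chain
`F` of `K`-subrepresentations with `F m = Σ_{a+b≤m} F^b E^a W₀` as subspaces, and every orthogonal splitting `F (m+1) = F m ⊕ Q (m+1)`, `Q 0 = F 0`: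
`dim Hom_K(τ, F 0) + Σ_{m<n} dim Hom_K(τ, Q (m+1)) ≤ B · dim τ` for all `n`.
[cite: Varadarajan1989, §5.4 Thm. 22] [cite: Knapp1986, Thm. 8.1] [cite: KnappVogan1995, §IV.6] -/
theorem u21_levelBound {x : GKIrrClass (uFormGroup (Fin 2) (Fin 1))}
    {E : Type} [NormedAddCommGroup E] [InnerProductSpace ℂ E] [CompleteSpace E] {ϖ : ContRepresentation ℂ (uFormGroup (Fin 2) (Fin 1)).carrier E}
    (hϖ : IsUnitaryGlobalization (uFormGroup (Fin 2) (Fin 1)) x ϖ) (W₀ : Submodule ℂ (harishChandraSpace (uFormGroup (Fin 2) (Fin 1)) ϖ))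
    [FiniteDimensional ℂ W₀]
    (hW₀ : ∀ (k : (uFormGroup (Fin 2) (Fin 1)).maximalCompact), ∀ w ∈ W₀, harishChandraRepK (uFormGroup (Fin 2) (Fin 1)) ϖ k w ∈ W₀) (hW₀ne : W₀ ≠ ⊥)
    (hirr : ∀ U : Submodule ℂ (harishChandraSpace (uFormGroup (Fin 2) (Fin 1)) ϖ), U ≤ W₀ →
      (∀ (k : (uFormGroup (Fin 2) (Fin 1)).maximalCompact), ∀ u ∈ U, harishChandraRepK (uFormGroup (Fin 2) (Fin 1)) ϖ k u ∈ U) → U = ⊥ ∨ U = W₀) :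
    ∃ B : ℕ, ∀ (W : Type) [AddCommGroup W] [Module ℂ W] [FiniteDimensional ℂ W]
      (τ : Representation ℂ (uFormGroup (Fin 2) (Fin 1)).maximalCompact W), τ.IsIrreducible →
      ∀ (F : ℕ → Subrepresentation (harishChandraRepK (uFormGroup (Fin 2) (Fin 1)) ϖ)),
        (∀ m, (F m).toSubmodule = upqPFiltration (harishChandraRepLie (uFormGroup (Fin 2) (Fin 1)) ϖ hϖ.isStronglyContinuous) W₀ m) →
      ∀ Q : ℕ → Subrepresentation (harishChandraRepK (uFormGroup (Fin 2) (Fin 1)) ϖ),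
        (∀ m, F (m + 1) = F m ⊔ Q (m + 1)) →
        (∀ m, Disjoint (F m).toSubmodule (Q (m + 1)).toSubmodule) →
        (∀ m, (Q (m + 1)).toSubmodule = (F (m + 1)).toSubmodule ⊓ (F m).toSubmoduleᗮ) →
        Q 0 = F 0 →
        ∀ n, finrank ℂ (Representation.IntertwiningMap τ (F 0).toRepresentation) +
          ∑ m ∈ Finset.range n, finrank ℂ (Representation.IntertwiningMap τ (Q (m + 1)).toRepresentation) ≤
            B * finrank ℂ W := by
  refine ⟨finrank ℂ W₀, fun W _ _ _ τ hτ F hF Q hsup hdisj hQ hQ0 n => ?_⟩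
  haveI : ∀ m, FiniteDimensional ℂ (F m).toSubmodule := fun m => by
    rw [hF m]; exact finiteDimensional_upqPFiltration (ρ𝔤 := harishChandraRepLie (uFormGroup (Fin 2) (Fin 1)) ϖ hϖ.isStronglyContinuous) W₀ m
  have htel := Literature.RepresentationTheory.finrank_intertwiningMap_eq_add_sum_orthogonal (σ := harishChandraRepK (uFormGroup (Fin 2) (Fin 1)) ϖ)
    τ F Q hsup hdisj hQ hQ0 n
  -- `dim τ ≥ 1`
  haveI : τ.IsIrreducible := hτ
  haveI : Nontrivial W := by
    by_contra hW
    rw [not_nontrivial_iff_subsingleton] at hW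
    haveI := (Submodule.subsingleton_iff ℂ).mpr hW
    exact hτ.bot_ne_top (Subrepresentation.toSubmodule_injective (Subsingleton.elim _ _))
  have hW1 : 1 ≤ finrank ℂ W := Module.finrank_pos
  calc finrank ℂ (Representation.IntertwiningMap τ (F 0).toRepresentation) +
          ∑ m ∈ Finset.range n, finrank ℂ (Representation.IntertwiningMap τ (Q (m + 1)).toRepresentation)
        = finrank ℂ (Representation.IntertwiningMap τ (F n).toRepresentation) := htel.symm
    _ ≤ finrank ℂ W₀ := u21_finrank_intertwiningMap_upqPFiltration_le hϖ W₀ hW₀ hW₀ne hirr τ hτ (F n) (hF n)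
    _ = finrank ℂ W₀ * 1 := (Nat.mul_one _).symm
    _ ≤ finrank ℂ W₀ * finrank ℂ W := Nat.mul_le_mul_left _ hW1

end Literature.NumberTheory.Automorphic

end
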